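import Mathlib
import HarnessLib
import Literature.MathematicalPhysics.QuantumLattice.KohnLuttinger
import Literature.MathematicalPhysics.QuantumLattice.KohnLuttingerFermiCurvePolar
import Literature.MathematicalPhysics.QuantumLattice.KohnLuttingerLindhardMeasurable
import Summits.HubbardSuperconductivity.HubbardSuperconductivity.Theorems.WeakCouplingBCSWcbcsKohnLuttingerB1gReduction
import Summits.HubbardSuperconductivity.HubbardSuperconductivity.Theorems.WeakCouplingBCSKlSublatticeCover

/-!
# The five pieces of the zone under the sublattice cover («sublattice-duality» discharge, part 2; seat p4 g20)

On the Brillouin zone `[-π, π)²` the folded cover `Φ = fold ∘ A` (`klslCover`) is piecewise affine: the zone is cut by the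
four lines `k₀ ± k₁ = ±π` into a central piece `P₀ = A⁻¹(BZ)` (where `Φ = A`) and four corner pieces `P₁ … P₄` (where
`Φ = A ∓ (2π, 0)`, `A ∓ (0, 2π)`).  The central piece maps onto the whole zone, the corner pieces onto four triangles
`Q₁ … Q₄` which tile the zone a second time.  This file records exactly that, in the form the measure transport needs:

* `klsl_restrict_pieces`    — `ν⌊BZ = ν⌊P₁ + ν⌊P₂ + ν⌊P₃ + ν⌊P₄ + ν⌊P₀` for every measure `ν` (successive bisections);
* `klsl_restrict_triangles` — `ν⌊Q₁ + ν⌊Q₂ + ν⌊Q₃ + ν⌊Q₄ = ν⌊BZ` (the triangles partition the zone exactly);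
* `klslCover_of_mem_P*`     — the affine formula for `Φ` on each piece;
* `klsl_preimage_Q*`        — each piece is the affine preimage of its triangle (`P₀` that of the zone).

Honest framing: linear inequalities only; nothing here asserts a margin, the window or superconductivity.
-/

noncomputable section

set_option linter.dupNamespace false

namespace Summit.HubbardSuperconductivity.HubbardSuperconductivity.Theorems

open MeasureTheory Real Set Literature.MathematicalPhysics.QuantumLattice
open scoped ENNReal Pointwise

/-! ### §4 The five pieces of the zone and the four triangles -/

/-- Unfolded membership in the half-open zone `[-π, π)²`. [folklore] -/
theorem klsl_mem_brillouinZone {k : Momentum} :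
    k ∈ brillouinZone ↔ (-π ≤ k 0 ∧ k 0 < π) ∧ (-π ≤ k 1 ∧ k 1 < π) := by
  simp [brillouinZone, Fin.forall_fin_two]

/-- Piece 1 of the zone: `k₀ + k₁ ≥ π` (there `Φ = A - (2π, 0)`). [folklore] -/
def klslP1 : Set Momentum := brillouinZone ∩ {k | π ≤ k 0 + k 1}

/-- Piece 2 of the zone: `k₀ + k₁ < -π` (there `Φ = A + (2π, 0)`). [folklore] -/
def klslP2 : Set Momentum := (brillouinZone \ {k | π ≤ k 0 + k 1}) ∩ {k | k 0 + k 1 < -π}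

/-- Piece 3 of the zone: `|k₀ + k₁|` small, `k₀ - k₁ ≥ π` (there `Φ = A - (0, 2π)`). [folklore] -/
def klslP3 : Set Momentum := ((brillouinZone \ {k | π ≤ k 0 + k 1}) \ {k | k 0 + k 1 < -π}) ∩ {k | π ≤ k 0 - k 1}

/-- Piece 4 of the zone: `|k₀ + k₁|` small, `k₀ - k₁ < -π` (there `Φ = A + (0, 2π)`). [folklore] -/
def klslP4 : Set Momentum :=
  (((brillouinZone \ {k | π ≤ k 0 + k 1}) \ {k | k 0 + k 1 < -π}) \ {k | π ≤ k 0 - k 1}) ∩ {k | k 0 - k 1 < -π}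

/-- Piece 0 of the zone: the central piece `A k ∈ BZ` (there `Φ = A`). [folklore] -/
def klslP0 : Set Momentum :=
  (((brillouinZone \ {k | π ≤ k 0 + k 1}) \ {k | k 0 + k 1 < -π}) \ {k | π ≤ k 0 - k 1}) \ {k | k 0 - k 1 < -π}

/-- Triangle 1 (left): `-π ≤ u₀`, `u₀ < u₁ < -u₀` — the image of piece 1. [folklore] -/
def klslQ1 : Set Momentum := {u | -π ≤ u 0 ∧ u 0 < u 1 ∧ u 1 < -(u 0)}

/-- Triangle 2 (right, closed diagonals): `u₀ < π`, `-u₀ ≤ u₁ ≤ u₀` — the image of piece 2. [folklore] -/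
def klslQ2 : Set Momentum := {u | u 0 < π ∧ -(u 0) ≤ u 1 ∧ u 1 ≤ u 0}

/-- Triangle 3 (bottom): `-π ≤ u₁`, `u₁ ≤ u₀ < -u₁` — the image of piece 3. [folklore] -/
def klslQ3 : Set Momentum := {u | -π ≤ u 1 ∧ u 1 ≤ u 0 ∧ u 0 < -(u 1)}

/-- Triangle 4 (top): `u₁ < π`, `-u₁ ≤ u₀ < u₁` — the image of piece 4. [folklore] -/
def klslQ4 : Set Momentum := {u | u 1 < π ∧ -(u 1) ≤ u 0 ∧ u 0 < u 1}

section Measurability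

/-- The first coordinate is measurable. [folklore] -/
theorem klsl_measurable_fst : Measurable fun k : Momentum => k 0 := (PiLp.continuous_apply 2 (fun _ : Fin 2 => ℝ) 0).measurable
/-- The second coordinate is measurable. [folklore] -/
theorem klsl_measurable_snd : Measurable fun k : Momentum => k 1 := (PiLp.continuous_apply 2 (fun _ : Fin 2 => ℝ) 1).measurable

/-- The half-plane `π ≤ k₀ + k₁` is measurable. [folklore] -/
theorem klsl_measurableSet_H1 : MeasurableSet {k : Momentum | π ≤ k 0 + k 1} :=
  measurableSet_le measurable_const (klsl_measurable_fst.add klsl_measurable_snd)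

/-- The half-plane `k₀ + k₁ < -π` is measurable. [folklore] -/
theorem klsl_measurableSet_H2 : MeasurableSet {k : Momentum | k 0 + k 1 < -π} :=
  measurableSet_lt (klsl_measurable_fst.add klsl_measurable_snd) measurable_const

/-- The half-plane `π ≤ k₀ - k₁` is measurable. [folklore] -/
theorem klsl_measurableSet_H3 : MeasurableSet {k : Momentum | π ≤ k 0 - k 1} :=
  measurableSet_le measurable_const (klsl_measurable_fst.sub klsl_measurable_snd)

/-- The half-plane `k₀ - k₁ < -π` is measurable. [folklore] -/
theorem klsl_measurableSet_H4 : MeasurableSet {k : Momentum | k 0 - k 1 < -π} :=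
  measurableSet_lt (klsl_measurable_fst.sub klsl_measurable_snd) measurable_const

/-- Triangle 1 is measurable. [folklore] -/
theorem klsl_measurableSet_Q1 : MeasurableSet klslQ1 :=
  (measurableSet_le measurable_const klsl_measurable_fst).inter
    ((measurableSet_lt klsl_measurable_fst klsl_measurable_snd).inter (measurableSet_lt klsl_measurable_snd klsl_measurable_fst.neg))

/-- Triangle 2 is measurable. [folklore] -/
theorem klsl_measurableSet_Q2 : MeasurableSet klslQ2 :=
  (measurableSet_lt klsl_measurable_fst measurable_const).inter
    ((measurableSet_le klsl_measurable_fst.neg klsl_measurable_snd).inter (measurableSet_le klsl_measurable_snd klsl_measurable_fst))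

/-- Triangle 3 is measurable. [folklore] -/
theorem klsl_measurableSet_Q3 : MeasurableSet klslQ3 :=
  (measurableSet_le measurable_const klsl_measurable_snd).inter
    ((measurableSet_le klsl_measurable_snd klsl_measurable_fst).inter (measurableSet_lt klsl_measurable_fst klsl_measurable_snd.neg))

/-- Triangle 4 is measurable. [folklore] -/
theorem klsl_measurableSet_Q4 : MeasurableSet klslQ4 :=
  (measurableSet_lt klsl_measurable_snd measurable_const).inter
    ((measurableSet_le klsl_measurable_snd.neg klsl_measurable_fst).inter (measurableSet_lt klsl_measurable_fst klsl_measurable_snd))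

end Measurability

/-- **The pieces exhaust the zone**: `ν⌊BZ = ν⌊P₁ + ν⌊P₂ + ν⌊P₃ + ν⌊P₄ + ν⌊P₀` for every measure (successive
measurable bisections, no disjointness bookkeeping needed). [folklore] -/
theorem klsl_restrict_pieces (ν : Measure Momentum) :
    ν.restrict brillouinZone =
      ν.restrict klslP1 + ν.restrict klslP2 + ν.restrict klslP3 + ν.restrict klslP4 + ν.restrict klslP0 := by
  rw [klslP1, klslP2, klslP3, klslP4, klslP0,
    ← Measure.restrict_inter_add_sdiff brillouinZone klsl_measurableSet_H1,
    ← Measure.restrict_inter_add_sdiff (brillouinZone \ {k | π ≤ k 0 + k 1}) klsl_measurableSet_H2,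
    ← Measure.restrict_inter_add_sdiff ((brillouinZone \ {k | π ≤ k 0 + k 1}) \ {k | k 0 + k 1 < -π}) klsl_measurableSet_H3,
    ← Measure.restrict_inter_add_sdiff
      (((brillouinZone \ {k | π ≤ k 0 + k 1}) \ {k | k 0 + k 1 < -π}) \ {k | π ≤ k 0 - k 1}) klsl_measurableSet_H4]
  abel

/-- **The four triangles tile the zone**: `ν⌊Q₁ + ν⌊Q₂ + ν⌊Q₃ + ν⌊Q₄ = ν⌊BZ` for every measure. [folklore] -/
theorem klsl_restrict_triangles (ν : Measure Momentum) :
    ν.restrict klslQ1 + ν.restrict klslQ2 + ν.restrict klslQ3 + ν.restrict klslQ4 = ν.restrict brillouinZone := by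
  have d12 : Disjoint klslQ1 klslQ2 := Set.disjoint_left.2 fun u h1 h2 => by
    obtain ⟨-, a, b⟩ := h1; obtain ⟨-, c, d⟩ := h2; linarith
  have d13 : Disjoint klslQ1 klslQ3 := Set.disjoint_left.2 fun u h1 h2 => by
    obtain ⟨-, a, b⟩ := h1; obtain ⟨-, c, d⟩ := h2; linarith
  have d23 : Disjoint klslQ2 klslQ3 := Set.disjoint_left.2 fun u h1 h2 => by
    obtain ⟨-, a, b⟩ := h1; obtain ⟨-, c, d⟩ := h2; linarith
  have d14 : Disjoint klslQ1 klslQ4 := Set.disjoint_left.2 fun u h1 h2 => by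
    obtain ⟨-, a, b⟩ := h1; obtain ⟨-, c, d⟩ := h2; linarith
  have d24 : Disjoint klslQ2 klslQ4 := Set.disjoint_left.2 fun u h1 h2 => by
    obtain ⟨-, a, b⟩ := h1; obtain ⟨-, c, d⟩ := h2; linarith
  have d34 : Disjoint klslQ3 klslQ4 := Set.disjoint_left.2 fun u h1 h2 => by
    obtain ⟨-, a, b⟩ := h1; obtain ⟨-, c, d⟩ := h2; linarith
  have hcover : klslQ1 ∪ klslQ2 ∪ klslQ3 ∪ klslQ4 = brillouinZone := by
    ext u
    simp only [mem_union, klslQ1, klslQ2, klslQ3, klslQ4, mem_setOf_eq, klsl_mem_brillouinZone]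
    constructor
    · rintro (((⟨a, b, c⟩ | ⟨a, b, c⟩) | ⟨a, b, c⟩) | ⟨a, b, c⟩) <;> exact ⟨⟨by linarith, by linarith⟩, by linarith, by linarith⟩
    · rintro ⟨⟨a, b⟩, c, d⟩
      by_cases h1 : -(u 0) ≤ u 1 ∧ u 1 ≤ u 0
      · exact Or.inl (Or.inl (Or.inr ⟨b, h1⟩))
      by_cases h2 : u 0 < u 1 ∧ u 1 < -(u 0)
      · exact Or.inl (Or.inl (Or.inl ⟨a, h2⟩))
      rw [not_and_or, not_le, not_le] at h1
      rw [not_and_or, not_lt, not_lt] at h2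
      by_cases h3 : u 1 < 0
      · refine Or.inl (Or.inr ⟨c, ?_, ?_⟩)
        · rcases h2 with h | h
          · exact h
          · rcases h1 with h' | h' <;> linarith
        · rcases h1 with h | h
          · rcases h2 with h' | h' <;> linarith
          · linarith
      · rw [not_lt] at h3
        refine Or.inr ⟨d, ?_, ?_⟩
        · rcases h1 with h | h
          · rcases h2 with h' | h' <;> linarith
          · rcases h2 with h' | h' <;> linarith
        · rcases h1 with h | h
          · rcases h2 with h' | h' <;> linarith
          · exact h
  rw [← hcover, Measure.restrict_union _ klsl_measurableSet_Q4, Measure.restrict_union _ klsl_measurableSet_Q3,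
    Measure.restrict_union d12 klsl_measurableSet_Q2]
  · exact Disjoint.union_left d13 d23
  · exact Disjoint.union_left (Disjoint.union_left d14 d24) d34

/-! ### §5 On each piece the cover is affine, and the piece is the affine preimage of its triangle -/

/-- The translation part `cᵢ` of the cover on the pieces: `(-2π, 0)`, `(2π, 0)`, `(0, -2π)`, `(0, 2π)`. [folklore] -/
def klslVec (a b : ℝ) : Momentum := WithLp.toLp 2 ![a, b]

/-- First component of `klslVec`. [folklore] -/
@[simp] theorem klslVec_apply_zero (a b : ℝ) : klslVec a b 0 = a := by simp [klslVec]

/-- Second component of `klslVec`. [folklore] -/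
@[simp] theorem klslVec_apply_one (a b : ℝ) : klslVec a b 1 = b := by simp [klslVec]

/-- On piece 1, `Φ k = A k - (2π, 0)`. [folklore] -/
theorem klslCover_of_mem_P1 {k : Momentum} (hk : k ∈ klslP1) : klslCover k = klslA k + klslVec (-(2 * π)) 0 := by
  simp only [klslP1, mem_inter_iff, klsl_mem_brillouinZone, mem_setOf_eq] at hk
  obtain ⟨⟨⟨a, b⟩, c, d⟩, e⟩ := hk
  ext i; fin_cases i
  · simp [klslCover, klslWrap_of_ge e]; ring
  · simp [klslCover, klslWrap_of_mem (x := k 0 - k 1) (by linarith) (by linarith)]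

/-- On piece 2, `Φ k = A k + (2π, 0)`. [folklore] -/
theorem klslCover_of_mem_P2 {k : Momentum} (hk : k ∈ klslP2) : klslCover k = klslA k + klslVec (2 * π) 0 := by
  simp only [klslP2, mem_inter_iff, mem_sdiff, klsl_mem_brillouinZone, mem_setOf_eq] at hk
  obtain ⟨⟨⟨⟨a, b⟩, c, d⟩, -⟩, e⟩ := hk
  ext i; fin_cases i
  · simp [klslCover, klslWrap_of_lt e]
  · simp [klslCover, klslWrap_of_mem (x := k 0 - k 1) (by linarith) (by linarith)]

/-- On piece 3, `Φ k = A k - (0, 2π)`. [folklore] -/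
theorem klslCover_of_mem_P3 {k : Momentum} (hk : k ∈ klslP3) : klslCover k = klslA k + klslVec 0 (-(2 * π)) := by
  simp only [klslP3, mem_inter_iff, mem_sdiff, klsl_mem_brillouinZone, mem_setOf_eq, not_le, not_lt] at hk
  obtain ⟨⟨⟨⟨⟨a, b⟩, c, d⟩, f⟩, g⟩, e⟩ := hk
  ext i; fin_cases i
  · simp [klslCover, klslWrap_of_mem g f]
  · simp [klslCover, klslWrap_of_ge e]; ring

/-- On piece 4, `Φ k = A k + (0, 2π)`. [folklore] -/
theorem klslCover_of_mem_P4 {k : Momentum} (hk : k ∈ klslP4) : klslCover k = klslA k + klslVec 0 (2 * π) := by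
  simp only [klslP4, mem_inter_iff, mem_sdiff, klsl_mem_brillouinZone, mem_setOf_eq, not_le, not_lt] at hk
  obtain ⟨⟨⟨⟨⟨⟨a, b⟩, c, d⟩, f⟩, g⟩, -⟩, e⟩ := hk
  ext i; fin_cases i
  · simp [klslCover, klslWrap_of_mem g f]
  · simp [klslCover, klslWrap_of_lt e]

/-- On piece 0, `Φ k = A k`. [folklore] -/
theorem klslCover_of_mem_P0 {k : Momentum} (hk : k ∈ klslP0) : klslCover k = klslA k + klslVec 0 0 := by
  simp only [klslP0, mem_sdiff, klsl_mem_brillouinZone, mem_setOf_eq, not_le, not_lt] at hk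
  obtain ⟨⟨⟨⟨⟨⟨a, b⟩, c, d⟩, f⟩, g⟩, h⟩, e⟩ := hk
  ext i; fin_cases i
  · simp [klslCover, klslWrap_of_mem g f]
  · simp [klslCover, klslWrap_of_mem e h]

/-- Piece 1 is the affine preimage of triangle 1. [folklore] -/
theorem klsl_preimage_Q1 : (fun k => klslA k + klslVec (-(2 * π)) 0) ⁻¹' klslQ1 = klslP1 := by
  ext k
  simp only [mem_preimage, klslQ1, klslP1, mem_setOf_eq, mem_inter_iff, klsl_mem_brillouinZone, PiLp.add_apply,
    klslA_apply_zero, klslA_apply_one, klslVec_apply_zero, klslVec_apply_one]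
  constructor
  · rintro ⟨a, b, c⟩; exact ⟨⟨⟨by linarith, by linarith⟩, by linarith, by linarith⟩, by linarith⟩
  · rintro ⟨⟨⟨a, b⟩, c, d⟩, e⟩; exact ⟨by linarith, by linarith, by linarith⟩

/-- Piece 2 is the affine preimage of triangle 2. [folklore] -/
theorem klsl_preimage_Q2 : (fun k => klslA k + klslVec (2 * π) 0) ⁻¹' klslQ2 = klslP2 := by
  ext k
  simp only [mem_preimage, klslQ2, klslP2, mem_setOf_eq, mem_inter_iff, mem_sdiff, klsl_mem_brillouinZone,
    PiLp.add_apply, klslA_apply_zero, klslA_apply_one, klslVec_apply_zero, klslVec_apply_one, not_le]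
  constructor
  · rintro ⟨a, b, c⟩; exact ⟨⟨⟨⟨by linarith, by linarith⟩, by linarith, by linarith⟩, by linarith⟩, by linarith⟩
  · rintro ⟨⟨⟨⟨a, b⟩, c, d⟩, -⟩, e⟩; exact ⟨by linarith, by linarith, by linarith⟩

/-- Piece 3 is the affine preimage of triangle 3. [folklore] -/
theorem klsl_preimage_Q3 : (fun k => klslA k + klslVec 0 (-(2 * π))) ⁻¹' klslQ3 = klslP3 := by
  ext k
  simp only [mem_preimage, klslQ3, klslP3, mem_setOf_eq, mem_inter_iff, mem_sdiff, klsl_mem_brillouinZone,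
    PiLp.add_apply, klslA_apply_zero, klslA_apply_one, klslVec_apply_zero, klslVec_apply_one, not_le, not_lt]
  constructor
  · rintro ⟨a, b, c⟩; exact ⟨⟨⟨⟨⟨by linarith, by linarith⟩, by linarith, by linarith⟩, by linarith⟩, by linarith⟩, by linarith⟩
  · rintro ⟨⟨⟨⟨⟨a, b⟩, c, d⟩, f⟩, g⟩, e⟩; exact ⟨by linarith, by linarith, by linarith⟩

/-- Piece 4 is the affine preimage of triangle 4. [folklore] -/
theorem klsl_preimage_Q4 : (fun k => klslA k + klslVec 0 (2 * π)) ⁻¹' klslQ4 = klslP4 := by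
  ext k
  simp only [mem_preimage, klslQ4, klslP4, mem_setOf_eq, mem_inter_iff, mem_sdiff, klsl_mem_brillouinZone,
    PiLp.add_apply, klslA_apply_zero, klslA_apply_one, klslVec_apply_zero, klslVec_apply_one, not_le, not_lt]
  constructor
  · rintro ⟨a, b, c⟩
    exact ⟨⟨⟨⟨⟨⟨by linarith, by linarith⟩, by linarith, by linarith⟩, by linarith⟩, by linarith⟩, by linarith⟩, by linarith⟩
  · rintro ⟨⟨⟨⟨⟨⟨a, b⟩, c, d⟩, f⟩, g⟩, -⟩, e⟩; exact ⟨by linarith, by linarith, by linarith⟩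

/-- Piece 0 is the preimage of the zone under `A` (every `k` with `A k ∈ BZ` lies in the zone). [folklore] -/
theorem klsl_preimage_Q0 : (fun k => klslA k + klslVec 0 0) ⁻¹' brillouinZone = klslP0 := by
  ext k
  simp only [mem_preimage, klslP0, mem_setOf_eq, mem_sdiff, klsl_mem_brillouinZone, PiLp.add_apply,
    klslA_apply_zero, klslA_apply_one, klslVec_apply_zero, klslVec_apply_one, not_le, not_lt, add_zero]
  constructor
  · rintro ⟨⟨a, b⟩, c, d⟩; exact ⟨⟨⟨⟨⟨⟨by linarith, by linarith⟩, by linarith, by linarith⟩, b⟩, a⟩, d⟩, c⟩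
  · rintro ⟨⟨⟨⟨⟨⟨a, b⟩, c, d⟩, f⟩, g⟩, h⟩, e⟩; exact ⟨⟨g, f⟩, e, h⟩


section PieceMeasurability

/-- Piece 1 is measurable. [folklore] -/
theorem klsl_measurableSet_P1 : MeasurableSet klslP1 := measurableSet_brillouinZone.inter klsl_measurableSet_H1

/-- Piece 2 is measurable. [folklore] -/
theorem klsl_measurableSet_P2 : MeasurableSet klslP2 :=
  (measurableSet_brillouinZone.diff klsl_measurableSet_H1).inter klsl_measurableSet_H2

/-- Piece 3 is measurable. [folklore] -/
theorem klsl_measurableSet_P3 : MeasurableSet klslP3 :=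
  ((measurableSet_brillouinZone.diff klsl_measurableSet_H1).diff klsl_measurableSet_H2).inter klsl_measurableSet_H3

/-- Piece 4 is measurable. [folklore] -/
theorem klsl_measurableSet_P4 : MeasurableSet klslP4 :=
  (((measurableSet_brillouinZone.diff klsl_measurableSet_H1).diff klsl_measurableSet_H2).diff
    klsl_measurableSet_H3).inter klsl_measurableSet_H4

/-- Piece 0 is measurable. [folklore] -/
theorem klsl_measurableSet_P0 : MeasurableSet klslP0 :=
  (((measurableSet_brillouinZone.diff klsl_measurableSet_H1).diff klsl_measurableSet_H2).diff
    klsl_measurableSet_H3).diff klsl_measurableSet_H4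

end PieceMeasurability

end Summit.HubbardSuperconductivity.HubbardSuperconductivity.Theorems

end
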